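import Literature.IUT.HodgeTheaters.PMBaseBridgePropsProofs

/-!
# Kernel DAG index — layer X = MIXED delta (L5 ×1; one file per cycle under the live-queue discipline); 1 DISCHARGE SIBLINGS `N_<id>'` — rule DSIB-1 (abc-iut-dag GO 2026-08-27T19:22:42Z, guards (a)–(g)): for a DATA node of a claim-kind row marked discharged(p…) the sibling binds, BY NAME, the theorems of the lead-designated proof module(s) — the p-id(s) of that token — whose CONCLUSION HEAD is the node's typed statement def (farm scan, ProducersScan conclusion-head rule; FACT-minimal choice per def: assumption-free dischargers preferred, others enter only when none exists and then their F-ids are named; conjuncts without discharger are listed and NOT claimed). A conclusion-head match is a kernel fact about the TYPED statement; whether a discharger discharges the PRINTED item is the referees' and leads' word (RQ7/REF passes, NODES.md), not this file's. Append-only: the data node stays; dag re-keys col 21 to the primed name, part zh (GENERATED by abc-iut-c312-2 gen 11 `work/gen_index.py` @2026-08-28T08:02Z from HOME/plan/DAG.tsv +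
KERNEL-DAG-MODULES.tsv (regenerated 2026-08-28T08:02:16Z): 1 landed/discharged nodes NOT YET in the tree index Summits/ABC/IUTFork/DAG*.lean; spec v1.3 §2 (M))

THIS FILE PROVES NOTHING NEW AND ASSERTS NOTHING (HOME/plan/KERNEL-DAG-SPEC.md). It gives ONE NAME `N_<kernel_id>` to each DAG node whose
statement has LANDED through the gate, knitting the landed declarations BY NAME: claim nodes `N_<id> : Prop := StatementOf @thm₁ ∧ …` (one
conjunct per landed theorem the DAG row names, universe levels instantiated explicitly per the spec's UNIVERSE RULE, arities read off the farm),
witnessed `N_<id>_holds` iff the DAG row is `discharged(p…)` and `N_<id>_part` otherwise (spec §2(b),(c); c312-2 F1/F2); data nodes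
`abbrev N_<id> := @<primary>` with the row's further declarations as `example := @…` lines; FACT-style `def … : Prop` declarations are data
here (a NAME, never asserted). Decl lists come from the `decls` column of plan/DAG.tsv as resolved against the tree sources (unresolvable
tokens dropped and reported to abc-iut-dag on STATUS). Nothing here says abc is proved or refuted or takes a side on [IUTchIII] Cor 3.12.
typed ≠ discharged; indexed ≠ endorsed.
-/

namespace Summit.ABC.IUTFork.DAG

namespace PartXzh
/-- `StatementOf h` is the statement (a `Prop`) of which the landed `h` is the proof: the index NAMES statements, it never re-types them. -/
abbrev StatementOf {P : Prop} (_h : P) : Prop := P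
end PartXzh
open PartXzh

noncomputable section
universe u₁ u₂ u₃ u₄ u₅ u₆ u₇ u₈ u₉ u₁₀ u₁₁ u₁₂ u₁₃ u₁₄ u₁₅ u₁₆


/-- [node IUTchI:Prop6.6(i) · L5/D2 · [IUTchI] Prop 6.6 (i), kurims p.165 · p408073 · claim · DAG status discharged(p408073)] decls 1 · DISCHARGE SIBLING of the data node `N_IUTchI_Prop6_6_i` (which binds the item's typed STATEMENT def): this sibling binds the theorems of the lead-designated proof module(s) — the p-id(s) of the row's own discharged(…) token — whose CONCLUSION HEAD is that statement (farm scan, ProducersScan conclusion-head rule; rule DSIB-1 guards (a)–(h); DSIB-2c: c312-2 g11 PROPOSAL 2026-08-28T07:30:47Z → abc-iut-L5-lead g13 RULINGS #297 07:31:47Z «NO STRIKE — IUTchI:Prop6.6(i)» (guards read first-hand by the chair) → abc-iut-dag g9 DECISION 07:37:42Z «GO DSIB-2c, the ONE ROW» (strike window closed affirmatively; file at the first cycle after that line)); append-only; dag: kernel_id := `N_IUTchI_Prop6_6_i'` · conjuncts NOT covered (bound statement defs with no discharger in the designated module(s); nothing claimed about them): `GluingTorsor`, `ExtendsToHT` ·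 designated proof p-ids p408073 · the item's OWN statement def(s): `IsoTorsor` (docstring locator [IUTchI] Prop 6.6 (i) on the bound def `DThetaPMBridge.IsoTorsor` (guard (c) satisfied: the node's abbrev target, the item's own statement; the two `example` defs GluingTorsor / ExtendsToHT of the block are the (iv)/(v) statements and are NOT covered here)) · late DSIB-2-class candidate (in-module): discharger `PMBaseKit.DThetaPMBridge.isoTorsor (B₁ B₂ : K.DThetaPMBridge) : IsoTorsor B₁ B₂` (★ p408073 PMBaseBridgePropsProofs.lean l.168; hypothesis-free beyond the bridge data, FA-0) — conclusion head = the node's own statement def `DThetaPMBridge.IsoTorsor`; first surfaced at the gen-11 re-scan 07:2xZ (not in gen 10's candidate cuts); binds (i) ONLY — GluingTorsor (iv) / ExtendsToHT (v) are listed as NOT covered (their own siblings N_IUTchI_Prop6_6_iv'/_v' exist since DSIB-1) and nothing is claimed about them · HONEST FRAMING: dischargers = OUR theorems about OUR typed statement, proved at our data / at a model where the designated module says so; discharged-at-our-data ≠ endorsed ≠ proved-in-print; census of record for the printed item = plan/L5/NODES.md; no side taken on [IUTchIII] Cor 3.12 · decl list as NAMED BY THE AUDITOR/LEAD (forced, not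 re-resolved) · cites→ IUTchI:Ex6.2 -/
abbrev N_IUTchI_Prop6_6_i' : Prop := StatementOf @Literature.IUT.HodgeTheaters.PMBaseKit.DThetaPMBridge.isoTorsor.{u₁}
/-- discharge of `N_IUTchI_Prop6_6_i'`: the landed theorems it names, BY NAME (spec §2(c)); proves nothing new. -/
theorem N_IUTchI_Prop6_6_i'_holds : N_IUTchI_Prop6_6_i' := @Literature.IUT.HodgeTheaters.PMBaseKit.DThetaPMBridge.isoTorsor

end

end Summit.ABC.IUTFork.DAG
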